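import Summits.QuantumFields.QCD.Theorems.ExtinctionBuildsQCD.Negative.InertiaPencil
import Summits.QuantumFields.QCD.Theorems.SpectralDefectExtinctionWindowExtinctionSpreadTorusBoxes
import HarnessLib

/-!
# The Wilson form on box-supported spinors and the chiral min–max on the box block
# (stub `stub_fluxTemplateHalf`, part 2 of 3)

Helper file for stub `stub_fluxTemplateHalf` (S5b-m) of line `free-volume-heavy-witness` (reshape r3)
of crux `Summit.QuantumFields.QCD.Theses.SpectralDefectExtinction.WindowExtinction`
(item stmt-QuantumFields-8964).  Tree vocabulary only (`wilsonDirac`, `spinorLift gammaFive`,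
`negRootCount`, `box`, `Torus.proj`).

* `fluxHalf_re_form_wilsonDirac_eq`: `Re⟨ψ, D_W(U,m,1)ψ⟩ = (m+4)‖ψ‖² − Σ_μ Σ_x Re⟨ψ_x, U_μ(x) ψ_{x+μ̂}⟩`
  (from the tree's `wilsonDirac_eq_sub_sum_wilsonHop`: `W_μ = F_μ ⊗ P⁻_μ + F_μᴴ ⊗ P⁺_μ`,
  `Re⟨ψ,Aᴴψ⟩ = Re⟨ψ,Aψ⟩`, `P⁻ + P⁺ = 1`); `fluxHalf_sum_torus_eq_sum_box`, `fluxHalf_box_neighbour_eq`: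
  for `2R+1 < n` the box `c + {-R,…,R}⁴` embeds in the torus and sums of box-supported functions pull
  back to `ℤ⁴`.
* `stub_fluxTemplateHalf_spectral` (registered): **chiral min–max on the box block.**  If the Wilson form
  is coercive on spinors supported on the image of the box, `Re⟨ψ, D_W(U,m,1)ψ⟩ ≥ κ‖ψ‖²` (`κ > 0`), then
  the principal block `A` of `Γ₅ D_W(U,m,1)` on the quark indices over the image of the box is
  invertible and has exactly `6(2R+1)⁴` negative eigenvalues: `A` is Hermitian, its forms are the forms
  of `Γ₅ D_W` on vectors extended by zero (`fluxHalf_form_submatrix_eq`), on the two chirality sectors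
  (`γ₅ = diag(1,1,−1,−1)`, each of dimension `6(2R+1)⁴`) `⟨v, Γ₅ D v⟩ = ±Re⟨v, D v⟩` is definite
  (`form_gammaFive_mul_of_chiral`), and Sylvester (`countP_neg_eq_of_chiral`,
  `card_le_card_eigenvalues_of_form_pos`) gives `n₋ = 6(2R+1)⁴`, `n₊ ≥ 6(2R+1)⁴`, hence no kernel.
-/

noncomputable section

namespace Summit.QuantumFields.QCD.Cruxes.WindowExtinction.FreeVolumeHeavyWitness

open Matrix MeasureTheory
open Literature.MathematicalPhysics Literature.MathematicalPhysics.QuantumLattice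
  Literature.MathematicalPhysics.QuantumFieldTheory Literature.Probability.LatticeModels
open Summit.QuantumFields.QCD.Theorems.ExtinctionBuildsQCD.Negative
open scoped BigOperators Classical ENNReal ComplexConjugate

/-! ## The Wilson form as mass term minus hopping forms, and the pull-back to the box -/

-- adapted from Summits/QuantumFields/QCD/Theorems/SpectralDefectExtinctionTipNoBindingStubPositivity.lean
/-- `Re⟨v, Aᴴ v⟩ = Re⟨v, A v⟩` for a complex square matrix `A`. -/
theorem fluxHalf_re_conjTranspose_mulVec {m : Type*} [Fintype m] (A : Matrix m m ℂ) (v : m → ℂ) :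
    (star v ⬝ᵥ Aᴴ *ᵥ v).re = (star v ⬝ᵥ A *ᵥ v).re := by
  rw [mulVec_conjTranspose, star_dotProduct_star, ← dotProduct_mulVec, Complex.star_def,
    Complex.conj_re]

-- adapted from Summits/QuantumFields/QCD/Theorems/SpectralDefectExtinctionTipNoBindingStubPositivity.lean
/-- Entrywise action of `F_μ ⊗ 1_spin` on a spinor, in (site × colour) × spin coordinates:
`((F_μ ⊗ 1)ψ)((x,a),α) = Σ_b U(x,μ)_{ab} ψ(x+μ̂,b,α)`. -/
theorem fluxHalf_linkHop_kronecker_one_mulVec {L : ℕ} [NeZero L] (U : GaugeConfig 4 L SU3) (μ : Fin 4)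
    (ψ : TorusSite 4 L × Fin 3 × Fin 4 → ℂ) (x : TorusSite 4 L) (a : Fin 3) (α : Fin 4) :
    (kroneckerMap (· * ·) (linkHop (fundamentalRep (Fin 3)) U μ) (1 : Matrix (Fin 4) (Fin 4) ℂ) *ᵥ
        (ψ ∘ Equiv.prodAssoc (TorusSite 4 L) (Fin 3) (Fin 4))) ((x, a), α) =
      ∑ b, (U (x, μ) : Matrix (Fin 3) (Fin 3) ℂ) a b * ψ (QuantumFieldTheory.Site.shift x μ, b, α) := by
  rw [mulVec, dotProduct, Fintype.sum_prod_type, Fintype.sum_prod_type,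
    Finset.sum_eq_single_of_mem (QuantumFieldTheory.Site.shift x μ) (Finset.mem_univ _)]
  · refine Finset.sum_congr rfl fun b _ => ?_
    simp only [kroneckerMap_apply, linkHop, of_apply, if_true, fundamentalRep_apply,
      Function.comp_apply, Equiv.prodAssoc_apply, one_apply, mul_ite, mul_one, mul_zero, ite_mul,
      zero_mul, Finset.sum_ite_eq, Finset.mem_univ, if_true]
  · intro y _ hy
    simp only [kroneckerMap_apply, linkHop, of_apply, if_neg hy, zero_mul, Finset.sum_const_zero]

-- adapted from Summits/QuantumFields/QCD/Theorems/SpectralDefectExtinctionTipNoBindingStubPositivity.lean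
/-- **The Wilson form as mass term minus hopping forms**:
`Re⟨ψ, D_W(U,m,1)ψ⟩ = (m+4)‖ψ‖² − Σ_μ Σ_x Re Σ_{a,α} conj ψ(x,a,α) Σ_b U(x,μ)_{ab} ψ(x+μ̂,b,α)`
(`D_W = (m+4)·1 − Σ_μ W_μ`, `W_μ = F_μ ⊗ P⁻_μ + F_μᴴ ⊗ P⁺_μ`, `Re⟨ψ,Aᴴψ⟩ = Re⟨ψ,Aψ⟩`,
`P⁻ + P⁺ = 1`). -/
theorem fluxHalf_re_form_wilsonDirac_eq {L : ℕ} [NeZero L] (U : GaugeConfig 4 L SU3) (m : ℝ)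
    (ψ : TorusSite 4 L × Fin 3 × Fin 4 → ℂ) :
    (star ψ ⬝ᵥ (wilsonDirac (fundamentalRep (Fin 3)) U m 1 *ᵥ ψ)).re =
      (m + 4) * ∑ i, ‖ψ i‖ ^ 2 -
        ∑ μ, ∑ x, (∑ a, ∑ α, conj (ψ (x, a, α)) * ∑ b, (U (x, μ) : Matrix (Fin 3) (Fin 3) ℂ) a b *
          ψ (QuantumFieldTheory.Site.shift x μ, b, α)).re := by
  have hρ : ∀ g, fundamentalRep (Fin 3) g ∈ Matrix.unitaryGroup (Fin 3) ℂ :=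
    fundamentalRep_mem_unitaryGroup
  set ρ := fundamentalRep (Fin 3)
  set e := Equiv.prodAssoc (TorusSite 4 L) (Fin 3) (Fin 4)
  set ψ' : (TorusSite 4 L × Fin 3) × Fin 4 → ℂ := ψ ∘ e
  set F : Fin 4 → Matrix ((TorusSite 4 L × Fin 3) × Fin 4) ((TorusSite 4 L × Fin 3) × Fin 4) ℂ :=
    fun μ => kroneckerMap (· * ·) (linkHop ρ U μ) (1 : Matrix (Fin 4) (Fin 4) ℂ) with hF
  -- the hopping term in direction `μ`: `Re⟨ψ, W_μ ψ⟩ = Re⟨ψ', (F_μ ⊗ 1) ψ'⟩`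
  have hW : ∀ μ, (star ψ ⬝ᵥ wilsonHop ρ U μ *ᵥ ψ).re = (star ψ' ⬝ᵥ F μ *ᵥ ψ').re := by
    intro μ
    have h2 : kroneckerMap (· * ·) (linkHop ρ U μ)ᴴ (chiralProjPlus μ) =
        (kroneckerMap (· * ·) (linkHop ρ U μ) (chiralProjPlus μ))ᴴ := by
      rw [conjTranspose_kronecker, chiralProjPlus_conjTranspose]
    rw [wilsonHop, reindex_apply, submatrix_mulVec_equiv, Equiv.symm_symm,
      dotProduct_comp_equiv_symm]
    change (star ψ' ⬝ᵥ _ *ᵥ ψ').re = _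
    rw [add_mulVec, dotProduct_add, Complex.add_re, h2, fluxHalf_re_conjTranspose_mulVec,
      ← Complex.add_re, ← dotProduct_add, ← add_mulVec, ← kronecker_add,
      chiralProjMinus_add_chiralProjPlus]
  -- `Re⟨ψ, Dψ⟩ = (m+4)‖ψ‖² − Σ_μ Re⟨ψ', (F_μ ⊗ 1) ψ'⟩`
  have hL : (star ψ ⬝ᵥ (wilsonDirac ρ U m 1 *ᵥ ψ)).re =
      (m + 4) * ∑ i, ‖ψ' i‖ ^ 2 - ∑ μ, (star ψ' ⬝ᵥ F μ *ᵥ ψ').re := by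
    rw [wilsonDirac_eq_sub_sum_wilsonHop ρ hρ U m, sub_mulVec, smul_mulVec, one_mulVec,
      sum_mulVec, dotProduct_sub, dotProduct_smul, dotProduct_sum, Complex.sub_re, smul_eq_mul,
      Complex.re_ofReal_mul, Complex.re_sum, re_star_dotProduct_self,
      Fintype.sum_equiv e (fun j => ‖ψ' j‖ ^ 2) (fun i => ‖ψ i‖ ^ 2) (fun _ => rfl)]
    simp only [hW]
  have hsq : ∑ i, ‖ψ' i‖ ^ 2 = ∑ i, ‖ψ i‖ ^ 2 :=
    Fintype.sum_equiv e (fun j => ‖ψ' j‖ ^ 2) (fun i => ‖ψ i‖ ^ 2) (fun _ => rfl)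
  -- the hopping forms entrywise
  have hR : ∀ μ, (star ψ' ⬝ᵥ F μ *ᵥ ψ').re = ∑ x, (∑ a, ∑ α, conj (ψ (x, a, α)) *
      ∑ b, (U (x, μ) : Matrix (Fin 3) (Fin 3) ℂ) a b * ψ (QuantumFieldTheory.Site.shift x μ, b, α)).re := by
    intro μ
    rw [dotProduct, Fintype.sum_prod_type, Fintype.sum_prod_type, Complex.re_sum]
    refine Finset.sum_congr rfl fun x _ => ?_
    congr 1
    refine Finset.sum_congr rfl fun a _ => Finset.sum_congr rfl fun α _ => ?_
    rw [Pi.star_apply, hF, fluxHalf_linkHop_kronecker_one_mulVec]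
    rfl
  rw [hL, hsq]
  simp only [hR]

/-- A neighbour of a box point is identified by its torus image (`2R+1 < n`). -/
theorem fluxHalf_box_neighbour_eq {n R : ℕ} (hn : 2 * R + 1 < n) (c : Fin 4 → ℤ) {y y' : Fin 4 → ℤ}
    (hy : y ∈ box 4 R) (hy' : y' ∈ box 4 R) (μ : Fin 4)
    (h : Torus.proj n (c + y') = Torus.proj n (c + (y + Pi.single μ 1))) :
    y' = y + Pi.single μ 1 := by
  funext k
  have hdvd : (n : ℤ) ∣ y' k - (y k + (Pi.single μ (1 : ℤ) : Fin 4 → ℤ) k) := by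
    have := (spread_proj_eq_iff n _ _).1 h k
    simpa only [Pi.add_apply, add_sub_add_left_eq_sub] using this
  have h1 := spread_abs_le_of_mem_box hy k
  have h2 := spread_abs_le_of_mem_box hy' k
  have h3 : |(Pi.single μ (1 : ℤ) : Fin 4 → ℤ) k| ≤ 1 := by
    by_cases hk : k = μ
    · subst hk; simp
    · simp [hk]
  have habs : |y' k - (y k + (Pi.single μ (1 : ℤ) : Fin 4 → ℤ) k)| < n := by
    have h4 : |y' k - (y k + (Pi.single μ (1 : ℤ) : Fin 4 → ℤ) k)| ≤
        |y' k| + (|y k| + |(Pi.single μ (1 : ℤ) : Fin 4 → ℤ) k|) :=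
      (abs_sub _ _).trans (add_le_add le_rfl (abs_add_le _ _))
    have h5 : (2 * R + 1 : ℤ) < n := by exact_mod_cast hn
    linarith
  have := Int.eq_zero_of_abs_lt_dvd hdvd habs
  rw [Pi.add_apply]
  linarith

/-- A sum over the torus of a function supported on the image of the box is a sum over the box. -/
theorem fluxHalf_sum_torus_eq_sum_box {n R : ℕ} [NeZero n] (hn : 2 * R + 1 < n) (c : Fin 4 → ℤ)
    (f : TorusSite 4 n → ℝ)
    (hf : ∀ x, (¬ ∃ y : ↥(box 4 R), Torus.proj n (c + (y : Fin 4 → ℤ)) = x) → f x = 0) :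
    ∑ x, f x = ∑ y ∈ box 4 R, f (Torus.proj n (c + y)) := by
  classical
  have hinj : ∀ y ∈ box 4 R, ∀ y' ∈ box 4 R,
      Torus.proj n (c + y) = Torus.proj n (c + y') → y = y' :=
    fun y hy y' hy' h => spread_proj_add_injective hn.le c hy hy' h
  rw [← Finset.sum_image hinj]
  symm
  refine Finset.sum_subset (Finset.subset_univ _) fun x _ hx => hf x ?_
  rintro ⟨⟨y, hy⟩, rfl⟩
  exact hx (Finset.mem_image.2 ⟨y, hy, rfl⟩)

/-- The shift of a projected box point is the projection of the shifted point. -/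
theorem fluxHalf_proj_add_shift (n : ℕ) (c y : Fin 4 → ℤ) (μ : Fin 4) :
    QuantumFieldTheory.Site.shift (Torus.proj n (c + y)) μ = Torus.proj n (c + (y + Pi.single μ 1)) := by
  rw [QuantumFieldTheory.Site.shift, ← add_assoc, spread_proj_add n (c + y), spread_proj_single]

/-! ## Chiral min–max on the box block -/

/-- Forms of a principal submatrix are forms of the matrix on vectors extended by zero. -/
theorem fluxHalf_form_submatrix_eq {m : Type*} [Fintype m] (H : Matrix m m ℂ) (S : m → Prop)
    [DecidablePred S] (cv : {i // S i} → ℂ) :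
    star cv ⬝ᵥ (H.submatrix Subtype.val Subtype.val *ᵥ cv) =
      star (extendByZero S cv) ⬝ᵥ (H *ᵥ extendByZero S cv) := by
  have key : ∀ F : m → ℂ, (∀ p, ¬ S p → F p = 0) → ∑ p, F p = ∑ q : {i // S i}, F q.val := by
    intro F hF
    rw [← Finset.sum_subtype (Finset.univ.filter S) (by simp)]
    exact (Finset.sum_subset (Finset.filter_subset _ _) fun p _ hp => hF p (by simpa using hp)).symm
  symm
  rw [dotProduct, key _ (fun p hp => by rw [Pi.star_apply, extendByZero_apply_of_neg _ hp, star_zero,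
    zero_mul])]
  refine Finset.sum_congr rfl fun q _ => ?_
  rw [Pi.star_apply, Pi.star_apply, extendByZero_apply_of_pos _ q.2, Subtype.coe_eta, mulVec, mulVec,
    dotProduct, dotProduct, key _ (fun p hp => by rw [extendByZero_apply_of_neg _ hp, mul_zero])]
  congr 1
  refine Finset.sum_congr rfl fun p _ => ?_
  rw [extendByZero_apply_of_pos _ p.2, Subtype.coe_eta, submatrix_apply]

/-- The spin-sign of `γ₅` on the upper components. -/
theorem fluxHalf_gammaFiveSign_of_lt (α : Fin 4) (h : α.val < 2) :
    (![1, 1, -1, -1] : Fin 4 → ℂ) α = 1 := by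
  fin_cases α <;> simp_all

/-- The spin-sign of `γ₅` on the lower components. -/
theorem fluxHalf_gammaFiveSign_of_not_lt (α : Fin 4) (h : ¬ α.val < 2) :
    (![1, 1, -1, -1] : Fin 4 → ℂ) α = -1 := by
  fin_cases α <;> simp_all

/-- `card {q : Fin 3 × Fin 4 // q.2 < 2} = 6` (colour × upper spin components). -/
theorem fluxHalf_card_colourHalfSpin : Fintype.card {q : Fin 3 × Fin 4 // q.2.val < 2} = 6 := by
  let e : {q : Fin 3 × Fin 4 // q.2.val < 2} ≃ Fin 3 × Fin 2 :=
    { toFun := fun q => (q.1.1, ⟨q.1.2.val, q.2⟩)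
      invFun := fun r => ⟨(r.1, ⟨r.2.val, by omega⟩), r.2.isLt⟩
      left_inv := fun q => Subtype.ext (Prod.ext rfl (Fin.ext rfl))
      right_inv := fun r => Prod.ext rfl (Fin.ext rfl) }
  rw [Fintype.card_congr e, Fintype.card_prod, Fintype.card_fin, Fintype.card_fin]

/-- The image of the box in the torus has `(2R+1)⁴` sites (`2R+1 < n`). -/
theorem fluxHalf_card_boxImage {n R : ℕ} [NeZero n] (hn : 2 * R + 1 < n) (c : Fin 4 → ℤ) :
    Fintype.card {x : TorusSite 4 n // ∃ y : ↥(box 4 R), Torus.proj n (c + (y : Fin 4 → ℤ)) = x} =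
      (2 * R + 1) ^ 4 := by
  rw [Fintype.card_of_subtype ((box 4 R).image fun y => Torus.proj n (c + y)) (fun x => ?_)]
  · rw [Finset.card_image_of_injOn (fun y hy y' hy' h =>
      spread_proj_add_injective hn.le c hy hy' h), card_box]
  · simp only [Finset.mem_image, Subtype.exists, exists_prop]

/-- **Registered helper `stub_fluxTemplateHalf_spectral` (chiral min–max on the box block).**  If the Wilson
form `Re⟨ψ, D_W(U,m,1)ψ⟩` is coercive on spinors
supported on the image of the box, then the box principal block of `Γ₅ D_W(U,m,1)` is invertible and has
exactly `6(2R+1)⁴` negative eigenvalues: the forms of the block on the two chirality sectors are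
`±Re⟨v, D v⟩` (definite), both sectors have dimension `6(2R+1)⁴`, Sylvester. -/
theorem stub_fluxTemplateHalf_spectral :
    ∀ (n : ℕ) [NeZero n] (R : ℕ) (c : Fin 4 → ℤ), 2 * R + 1 < n → ∀ (U : GaugeConfig 4 n SU3) (m κ : ℝ), 0 < κ →
      (∀ ψ : TorusSite 4 n × Fin 3 × Fin 4 → ℂ,
        (∀ p : TorusSite 4 n × Fin 3 × Fin 4, (¬ ∃ y : ↥(box 4 R), Torus.proj n (c + (y : Fin 4 → ℤ)) = p.1) → ψ p = 0) →
        κ * ∑ i, ‖ψ i‖ ^ 2 ≤ (star ψ ⬝ᵥ (wilsonDirac (fundamentalRep (Fin 3)) U m 1 *ᵥ ψ)).re) →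
      ((spinorLift gammaFive * wilsonDirac (fundamentalRep (Fin 3)) U m 1).submatrix
          (Subtype.val : {p : TorusSite 4 n × Fin 3 × Fin 4 //
            ∃ y : ↥(box 4 R), Torus.proj n (c + (y : Fin 4 → ℤ)) = p.1} → _) Subtype.val).det ≠ 0 ∧
      negRootCount ((spinorLift gammaFive * wilsonDirac (fundamentalRep (Fin 3)) U m 1).submatrix
          (Subtype.val : {p : TorusSite 4 n × Fin 3 × Fin 4 //
            ∃ y : ↥(box 4 R), Torus.proj n (c + (y : Fin 4 → ℤ)) = p.1} → _) Subtype.val) =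
        6 * (2 * R + 1) ^ 4 := by
  intro n _ R c hn U m κ hκ hcoer
  set D := wilsonDirac (fundamentalRep (Fin 3)) U m 1 with hD
  set Γ : Matrix (TorusSite 4 n × Fin 3 × Fin 4) (TorusSite 4 n × Fin 3 × Fin 4) ℂ := spinorLift gammaFive with hΓ
  have hHh : (Γ * D).IsHermitian :=
    Literature.Barriers.QuantumFields.isHermitian_gammaFive_mul_wilsonDirac (fundamentalRep (Fin 3))
      fundamentalRep_mem_unitaryGroup U m 1
  set A := (Γ * D).submatrix
    (Subtype.val : {p : TorusSite 4 n × Fin 3 × Fin 4 // ∃ y : ↥(box 4 R), Torus.proj n (c + (y : Fin 4 → ℤ)) = p.1} → _)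
    (Subtype.val : {p : TorusSite 4 n × Fin 3 × Fin 4 // ∃ y : ↥(box 4 R), Torus.proj n (c + (y : Fin 4 → ℤ)) = p.1} → _) with hA
  have hAh : A.IsHermitian := hHh.submatrix _
  -- chiral sectors of the block
  set Pp : {p : TorusSite 4 n × Fin 3 × Fin 4 // ∃ y : ↥(box 4 R), Torus.proj n (c + (y : Fin 4 → ℤ)) = p.1} → Prop :=
    fun p => p.val.2.2.val < 2 with hPp
  set Ep := extendByZero Pp with hEp
  set Em := extendByZero (fun i => ¬ Pp i) with hEm
  have hΓp : ∀ cv, Γ *ᵥ extendByZero (fun p : TorusSite 4 n × Fin 3 × Fin 4 => ∃ y : ↥(box 4 R), Torus.proj n (c + (y : Fin 4 → ℤ)) = p.1) (Ep cv) =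
      (1 : ℂ) • extendByZero (fun p : TorusSite 4 n × Fin 3 × Fin 4 => ∃ y : ↥(box 4 R), Torus.proj n (c + (y : Fin 4 → ℤ)) = p.1) (Ep cv) := by
    intro cv
    rw [one_smul]
    funext p
    rw [hΓ, spinorLift_gammaFive_eq_diagonal, mulVec_diagonal]
    by_cases hp : ∃ y : ↥(box 4 R), Torus.proj n (c + (y : Fin 4 → ℤ)) = p.1
    · rw [extendByZero_apply_of_pos (p := fun p : TorusSite 4 n × Fin 3 × Fin 4 => ∃ y : ↥(box 4 R), Torus.proj n (c + (y : Fin 4 → ℤ)) = p.1) _ hp]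
      by_cases hq : p.2.2.val < 2
      · rw [fluxHalf_gammaFiveSign_of_lt _ hq, one_mul]
      · have : Ep cv ⟨p, hp⟩ = 0 := extendByZero_apply_of_neg _ hq
        rw [this, mul_zero]
    · rw [extendByZero_apply_of_neg (p := fun p : TorusSite 4 n × Fin 3 × Fin 4 => ∃ y : ↥(box 4 R), Torus.proj n (c + (y : Fin 4 → ℤ)) = p.1) _ hp, mul_zero]
  have hΓm : ∀ cv, Γ *ᵥ extendByZero (fun p : TorusSite 4 n × Fin 3 × Fin 4 => ∃ y : ↥(box 4 R), Torus.proj n (c + (y : Fin 4 → ℤ)) = p.1) (Em cv) =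
      (-1 : ℂ) • extendByZero (fun p : TorusSite 4 n × Fin 3 × Fin 4 => ∃ y : ↥(box 4 R), Torus.proj n (c + (y : Fin 4 → ℤ)) = p.1) (Em cv) := by
    intro cv
    rw [neg_one_smul]
    funext p
    rw [Pi.neg_apply, hΓ, spinorLift_gammaFive_eq_diagonal, mulVec_diagonal]
    by_cases hp : ∃ y : ↥(box 4 R), Torus.proj n (c + (y : Fin 4 → ℤ)) = p.1
    · rw [extendByZero_apply_of_pos (p := fun p : TorusSite 4 n × Fin 3 × Fin 4 => ∃ y : ↥(box 4 R), Torus.proj n (c + (y : Fin 4 → ℤ)) = p.1) _ hp]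
      by_cases hq : p.2.2.val < 2
      · have : Em cv ⟨p, hp⟩ = 0 := extendByZero_apply_of_neg _ (fun h => h hq)
        rw [this, mul_zero, neg_zero]
      · rw [fluxHalf_gammaFiveSign_of_not_lt _ hq, neg_one_mul]
    · rw [extendByZero_apply_of_neg (p := fun p : TorusSite 4 n × Fin 3 × Fin 4 => ∃ y : ↥(box 4 R), Torus.proj n (c + (y : Fin 4 → ℤ)) = p.1) _ hp, mul_zero, neg_zero]
  have hsupp : ∀ v : {p : TorusSite 4 n × Fin 3 × Fin 4 // ∃ y : ↥(box 4 R), Torus.proj n (c + (y : Fin 4 → ℤ)) = p.1} → ℂ, ∀ p : TorusSite 4 n × Fin 3 × Fin 4, (¬ ∃ y : ↥(box 4 R), Torus.proj n (c + (y : Fin 4 → ℤ)) = p.1) →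
      extendByZero (fun p : TorusSite 4 n × Fin 3 × Fin 4 => ∃ y : ↥(box 4 R), Torus.proj n (c + (y : Fin 4 → ℤ)) = p.1) v p = 0 :=
    fun v p hp => extendByZero_apply_of_neg (p := fun p : TorusSite 4 n × Fin 3 × Fin 4 => ∃ y : ↥(box 4 R), Torus.proj n (c + (y : Fin 4 → ℤ)) = p.1) _ hp
  have hpos : ∀ cv, cv ≠ 0 → 0 < (star (Ep cv) ⬝ᵥ (A *ᵥ Ep cv)).re := by
    intro cv hcv
    rw [hA, fluxHalf_form_submatrix_eq, form_gammaFive_mul_of_chiral D _ 1 (hΓp cv), map_one, one_mul]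
    have hv0 : extendByZero (fun p : TorusSite 4 n × Fin 3 × Fin 4 => ∃ y : ↥(box 4 R), Torus.proj n (c + (y : Fin 4 → ℤ)) = p.1) (Ep cv) ≠ 0 :=
      extendByZero_ne_zero (extendByZero_ne_zero hcv)
    have h := hcoer _ (hsupp (Ep cv))
    have hN := sum_norm_sq_pos hv0
    nlinarith
  have hneg : ∀ cv, cv ≠ 0 → (star (Em cv) ⬝ᵥ (A *ᵥ Em cv)).re < 0 := by
    intro cv hcv
    rw [hA, fluxHalf_form_submatrix_eq, form_gammaFive_mul_of_chiral D _ (-1) (hΓm cv), map_neg, map_one,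
      neg_one_mul, Complex.neg_re]
    have hv0 : extendByZero (fun p : TorusSite 4 n × Fin 3 × Fin 4 => ∃ y : ↥(box 4 R), Torus.proj n (c + (y : Fin 4 → ℤ)) = p.1) (Em cv) ≠ 0 :=
      extendByZero_ne_zero (extendByZero_ne_zero hcv)
    have h := hcoer _ (hsupp (Em cv))
    have hN := sum_norm_sq_pos hv0
    nlinarith
  -- cardinalities
  have hN := fluxHalf_card_boxImage hn c
  have hcardι : Fintype.card {p : TorusSite 4 n × Fin 3 × Fin 4 // ∃ y : ↥(box 4 R), Torus.proj n (c + (y : Fin 4 → ℤ)) = p.1} = (2 * R + 1) ^ 4 * 12 := by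
    rw [Fintype.card_congr (Equiv.prodSubtypeFstEquivSubtypeProd
      (p := fun x : TorusSite 4 n => ∃ y : ↥(box 4 R), Torus.proj n (c + (y : Fin 4 → ℤ)) = x)), Fintype.card_prod, hN]
    simp
  have hcardp : Fintype.card {i // Pp i} = (2 * R + 1) ^ 4 * 6 := by
    have e : {i // Pp i} ≃ {x : TorusSite 4 n // ∃ y : ↥(box 4 R), Torus.proj n (c + (y : Fin 4 → ℤ)) = x} × {q : Fin 3 × Fin 4 // q.2.val < 2} :=
      (Equiv.subtypeSubtypeEquivSubtypeInter (fun p : TorusSite 4 n × Fin 3 × Fin 4 => ∃ y : ↥(box 4 R), Torus.proj n (c + (y : Fin 4 → ℤ)) = p.1)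
        fun p : TorusSite 4 n × Fin 3 × Fin 4 => p.2.2.val < 2).trans
        (Equiv.subtypeProdEquivProd (p := fun x : TorusSite 4 n => ∃ y : ↥(box 4 R), Torus.proj n (c + (y : Fin 4 → ℤ)) = x)
          (q := fun q : Fin 3 × Fin 4 => q.2.val < 2))
    rw [Fintype.card_congr e, Fintype.card_prod, hN, fluxHalf_card_colourHalfSpin]
  have hcardm : Fintype.card {i // ¬ Pp i} = 6 * (2 * R + 1) ^ 4 := by
    rw [Fintype.card_subtype_compl, hcardι, hcardp]
    omega
  have hcard : Fintype.card {i // Pp i} + Fintype.card {i // ¬ Pp i} =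
      Fintype.card {p : TorusSite 4 n × Fin 3 × Fin 4 // ∃ y : ↥(box 4 R), Torus.proj n (c + (y : Fin 4 → ℤ)) = p.1} := by
    rw [hcardp, hcardm, hcardι]; ring
  -- conclusion
  have hnegc := countP_neg_eq_of_chiral hAh Ep Em hpos hneg hcard
  have hposc := card_le_card_eigenvalues_of_form_pos hAh 1 Ep (fun cv hcv => by
    rw [one_mul]; exact hpos cv hcv)
  simp only [one_mul] at hposc
  refine ⟨?_, ?_⟩
  · have h3 := negRootCount_add_posRootCount_add_zeroRootCount hAh
    rw [negRootCount, hnegc, posRootCount_eq_card hAh, hcardm, hcardι] at h3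
    rw [hcardp] at hposc
    have hz : zeroRootCount A = 0 := by omega
    rw [zeroRootCount_eq_card hAh, Finset.card_eq_zero, Finset.filter_eq_empty_iff] at hz
    rw [hAh.det_eq_prod_eigenvalues, Finset.prod_ne_zero_iff]
    exact fun i _ => Complex.ofReal_ne_zero.2 (hz (Finset.mem_univ i))
  · rw [negRootCount, hnegc, hcardm]

/-! ## Scalar centre elements of `SU(3)` -/

/-- Scalar centre-type elements: `u • 1 ∈ SU(3)` for `|u| = 1`, `u³ = 1`. -/
theorem fluxHalf_smul_one_mem_specialUnitaryGroup (u : ℂ) (hu : Complex.normSq u = 1) (hu3 : u ^ 3 = 1) :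
    u • (1 : Matrix (Fin 3) (Fin 3) ℂ) ∈ Matrix.specialUnitaryGroup (Fin 3) ℂ := by
  rw [Matrix.mem_specialUnitaryGroup_iff, Matrix.mem_unitaryGroup_iff]
  constructor
  · rw [star_eq_conjTranspose, conjTranspose_smul, conjTranspose_one, Matrix.smul_mul,
      Matrix.one_mul, smul_smul, Complex.star_def, Complex.mul_conj, hu, Complex.ofReal_one, one_smul]
  · rw [det_smul, det_one, mul_one, Fintype.card_fin, hu3]

end Summit.QuantumFields.QCD.Cruxes.WindowExtinction.FreeVolumeHeavyWitness

end
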